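import Summits.QuantumFields.QCD.Theorems.PauliWegnerSeaChiralGluonicCompletionGlobalContinuum
import Literature.MathematicalPhysics.QuantumFieldTheory.QCDTransferMatrix
import Literature.MathematicalPhysics.QuantumLattice.TraceInequalitiesProofs

/-!
# Stub `stub_latticeGap_of_normGap_coldPressure` (crux stmt-QuantumFields-17498, line `Sketch_ideator5_r2`) — audit + assembly helpers

AUDIT NOTE (worker W4, 2026-08-17; verdict `stub-blocked`, the stub itself is NOT proved here).  Map of the content
`TT + V + P₂ ⇒ (reg.scheme m 0 0).HasLatticeMassGap Δ'` (size XL) against the tree: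
* (R) `qcdTorusExpect = Tr[Γ𝕋ᴺX̂]/Tr[Γ𝕋ᴺ]` (PERIODIC functional).  Denominator, KERNEL level: LANDED
  `…StableActionBridge.Sketch.integral_fermiBoltzmann_wilsonMeasure_eq_cyclic_supertrace` (TorusDenominator ← CyclicSupertrace
  (Flavour), SupertraceTransferForm, DiracMatrixSupertrace, WilsonSliceReduction).  Numerator: LANDED only for Grassmann-CONSTANT
  continuous `Φ(U)·1` (`qcd_boltzmann_integral_mul_eq_cyclic_supertrace`, `qcdTorusExpect_gaugeObservable_eq_cyclic_ratio`,
  GluonicExpectation; `Φ` read on assembled slices, temporal links not gauge-fixed into one-slice operators).  Quark insertions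
  (`QCDLatticeObservable.onTorus` ↦ Fock operators under the slicing map): NOTHING landed (no Theorems file relates `onTorus` to
  `fermionSliceOp`).  Kernel → OPERATOR level (`= Σᵢ σᵢ λᵢᴺ` over a joint eigenbasis of `𝕋`, `(−1)^F`): OPEN = crux 9737 sub-goals
  B5 `stub_cyclic_scalarise`, D `stub_torusDenominators_spectral` (A1 `stub_cyclicPeelC`, A2 `stub_spectralTraceC` — ONE insertion,
  DIAGONAL in the Fock basis —, B1–B4 landed as Theorems/…Stub*.lean).
* (S) levels ↔ spectrum: LANDED for levels 0, 1 only (`…PinTheInfimum.qcdTransferLevel_eq_embedded_levels`, `cluster_of_levels` /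
  `transfer_cluster` p152624, `qcdTransferLevel_one_pos`, `qcdTransferGap_eq_neg_log_div`; W2's `le_qcdTransferGap_iff_level_ratio`):
  V ⇒ `‖R‖ ≤ e^{−a_kΔ}` is available operator-side.  NOT landed: `qcdTransferLevel n ≥` n-th eigenvalue with multiplicity, `n ≥ 2`
  (easy min–max direction over the dense embedded core + sorted Hilbert eigenbasis) — needed to read P₂ as `Tr_V R^{S+1} ≤ θ_{S+1}`.
* (TT∞) TT is over `Matrix n n ℂ`, `𝕋` acts on infinite-dimensional `L²`: finite-rank spectral compression + HS limits (no trace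
  class in Mathlib; `HasSum` over Hilbert bases as in StubSpectralTraceC).  The landed FiniteDimensional `TransferData` comparisons
  (`twisted_connected_sub_vacuum_le`, `twisted_twoPoint_*`, `twisted_expectation_*`, `twisted_vacuum_dominance`,
  `thermal_smallness_le_*`, `stub_twistedTraceComparison`) need `Re Tr T^{L−n} − 1` SMALL and give no decay: CorrelatorReturn
  currency, not usable with P₂ (θ bounded only).
* (B) norms of slice operators of `onTorus` insertions: nothing landed.  Uniform in `U, S` at fixed masses (`QCDLatticeObservable.bounded`;
  `spec A_red(U) ⊆ [1 + min m_f, 7 + max m_f]`), but the Lüscher/Smit dictionary carries `sliceMassHop^{∓1/2}` factors with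
  `‖A_red(U)⁻¹‖` up to `1/(1 + min_f m_f(k))`, and ClauseI types only the OPEN range `−1 < m_f(k)` eventually: (B) needs a margin
  `∃ η > 0, ∀ f, ∀ᶠ k, η − 1 ≤ m_f(k)` or `m`-uniform bounds for DRESSED insertions `T_F^{1/2} Ô T_F^{1/2}` (Euclidean correlators stay
  bounded as `m → −1⁺`, operator norms do not).  Caveat for the reshape, not a falsification.
* V, P₂ suffice in principle: `|Tr[Γρᴺ] − 1| ≤ Tr Rᴺ ≤ ‖R‖^S θ_{S+1} → 0` uniformly on `S ≥ L_k` (`re_trace_pow_add_le` below,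
  `reg.tendsto_L`); one-point thermal parts at power `N − w ≥ S+1`; `ΓΩ = ±Ω` either sign (ratios invariant under `Γ ↦ −Γ`); small
  `n` by uniform boundedness (`hasLatticeMassGap_of_offset_bounds` below).  GAP IN TT AS TYPED: for observables of temporal widths
  `w_A, w_B` and `S − w_A − w_B < n ≤ S` BOTH free stretches `t₁ = n − w_A − w_B`, `t₂ = 2S+1 − n − w_A − w_B` are `≤ S`, so TT(1)
  (trace at ONE power) does not control the doubly-thermal term `Tr[ΓR^{t₂}ÂR^{t₁}B̂]`; the Hilbert–Schmidt split
  `norm_trace_two_thermal_le(_of_le)` below (PROVED: `≤ ‖Â‖‖B̂‖ ‖R‖^{t₁+t₂−p} Re Tr R^p` once `p ≤ 2t₁, 2t₂`) closes it with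
  `p = S+1`, `t₁ + t₂ − p = S − w_A − w_B` — add it as TT(4) of the skeleton (or re-type P₂ at power `⌊S/2⌋ + 1`).
* Nearest named fact: crux 8892 `Summit.QuantumFields.QCD.Cruxes.RobustYangMillsHandover.PinTheInfimum.stub_spectralDictionary`,
  (⇐) conjunct at `t = m`, `ε = Δ`: `(∀ᶠ k, ∀ S ≥ L_k, Δ a_k ≤ transferGapAt reg m k S) → HasLatticeMassGap (Δ/2)` = this stub
  minus P₂ (its STATUS note names the missing M6 = vacuum dominance, which V + P₂ supply: `Σ_{i≠0}(λᵢ/λ₀)^{2S+1} ≤ ‖R‖^S θ_{S+1}`).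
  Residual if it lands AS BUNDLED: its antecedent (X₀ continuum data `∀ m > 0, ∃ z shift T, IsQCDAlong … ∧ …`) is not in `Hyp`;
  consumable only as a standalone (⇐) over `range ∧ (∀ᶠ k, 0 ≤ β_k)` (Hyp: ClauseI; asymptotic scaling, W2's
  `uniformNormGap_rangeGuard`).  Farther: crux 9737 `…StableActionBridge.TwistedTraceTransfer.CorrelatorReturn`
  (`stub_correlatorComparison`) needs `LowTemperaturePressureAt` (`Σ(λᵢ/λ₀)^t ≤ C e^{−Δth a_k t}` for `t ≥ θS`, every `θ > 0`) —
  NOT implied by V + P₂ (nothing below power `S+1`) — and still leaves `HasThermalLatticeMassGap` from V, i.e. the same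
  (R)(S)(TT∞)(B) debt for the antiperiodic functional (M2 `transfer_cluster` landed, M1 open).

Proved below (pure bookkeeping the assembly consumes; no physics, no new definitions): the entropy-sum transport
`Re Tr R^{q+p} ≤ ‖R‖^q Re Tr R^p`, the Hilbert–Schmidt split of the doubly-thermal twisted trace, and the passage from
"uniformly bounded for `n ≤ w`, decaying in `n − w` beyond" to `QCDScheme.HasLatticeMassGap`.
-/

noncomputable section

open MeasureTheory Filter Topology Matrix
open scoped Matrix.Norms.L2Operator ComplexOrder
open Literature.MathematicalPhysics.QuantumFieldTheory Literature.MathematicalPhysics.QuantumLattice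
  Literature.Probability.LatticeModels
open Summit.QuantumFields.QCD.Theorems.StronglyChiralSubsequence

namespace Summit.QuantumFields.QCD.Theorems.AnomalyBranch

namespace LatticeGapAssembly

/-! ### Finite-dimensional trace bookkeeping (`‖·‖` = the `ℓ²` operator norm of `Matrix.Norms.L2Operator`) -/

section Matrices

variable {n : Type*} [Fintype n] [DecidableEq n]

/-- **Transport of the thermal entropy sum to higher powers.**  For `R ≥ 0`:
`Re Tr R^{q+p} ≤ ‖R‖^q · Re Tr R^p` (Hölder `|Tr[O X]| ≤ ‖O‖ Re Tr X` with `O = R^q`, `X = R^p ≥ 0`).  With `q = S`,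
`p = S + 1` this is `θ_{2S+1} ≤ ‖R‖^S θ_{S+1}`: the twisted normalisation `Tr[Γρ^{2S+1}] − 1` is controlled by the
cold-pressure number at aspect ratio `2` and the norm gap. [cite: KomaTasakiPRL1992, proof of eq. (10), inequality ii)] -/
theorem re_trace_pow_add_le {R : Matrix n n ℂ} (hR : R.PosSemidef) (q p : ℕ) :
    ((R ^ (q + p)).trace).re ≤ ‖R‖ ^ q * ((R ^ p).trace).re := by
  have hRp : (R ^ p).PosSemidef := hR.pow p
  have hp0 : 0 ≤ ((R ^ p).trace).re := by
    simpa only [RCLike.re_to_complex] using re_trace_nonneg_of_posSemidef hRp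
  have h := norm_trace_mul_le_opNorm_mul_re_trace (R ^ q) hRp
  rw [← pow_add] at h
  rcases Nat.eq_zero_or_pos q with rfl | hq
  · simp
  · calc ((R ^ (q + p)).trace).re ≤ ‖(R ^ (q + p)).trace‖ := Complex.re_le_norm _
      _ ≤ ‖R ^ q‖ * ((R ^ p).trace).re := h
      _ ≤ ‖R‖ ^ q * ((R ^ p).trace).re := mul_le_mul_of_nonneg_right (norm_pow_le' R hq) hp0

/-- `Re Tr(Aᴴ X A) ≤ ‖A‖² Re Tr X` for `X ≥ 0` (cyclicity and Hölder with `O = A Aᴴ`, `‖A Aᴴ‖ = ‖A‖²`). -/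
theorem re_trace_conjTranspose_mul_mul_le (A : Matrix n n ℂ) {X : Matrix n n ℂ} (hX : X.PosSemidef) :
    ((Aᴴ * (X * A)).trace).re ≤ ‖A‖ ^ 2 * (X.trace).re := by
  have hcyc : (Aᴴ * (X * A)).trace = (A * Aᴴ * X).trace := by
    rw [trace_mul_comm, Matrix.mul_assoc, trace_mul_comm]
  have hAA : ‖A * Aᴴ‖ = ‖A‖ ^ 2 := by
    have h := l2_opNorm_conjTranspose_mul_self Aᴴ
    rw [conjTranspose_conjTranspose, l2_opNorm_conjTranspose] at h
    rw [h, sq]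
  calc ((Aᴴ * (X * A)).trace).re ≤ ‖(Aᴴ * (X * A)).trace‖ := Complex.re_le_norm _
    _ = ‖(A * Aᴴ * X).trace‖ := by rw [hcyc]
    _ ≤ ‖A * Aᴴ‖ * (X.trace).re := norm_trace_mul_le_opNorm_mul_re_trace _ hX
    _ = ‖A‖ ^ 2 * (X.trace).re := by rw [hAA]

/-- **Hilbert–Schmidt split of the doubly-thermal twisted trace.**  For `R ≥ 0`, a Hermitian involution `Γ`
(`Γᴴ = Γ`, `Γ² = 1`) and arbitrary insertions `A, B`:
`|Tr[Γ R^a A R^b B]| ≤ ‖A‖ ‖B‖ (Re Tr R^{2a})^{1/2} (Re Tr R^{2b})^{1/2}` — Schwarz for the trace form with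
`X = Γ R^a A`, `Y = R^b B`, then `Tr(XᴴX) = Tr(Aᴴ R^{2a} A) ≤ ‖A‖² Tr R^{2a}` and likewise for `Y`.  Unlike the one-power
Hölder bound `‖A‖‖B‖‖R‖^b Re Tr R^a` it puts BOTH stretches at the doubled powers `2a`, `2b`, which is what the
cold-pressure hypothesis at power `S+1` controls when `a, b ≤ S` but `2a, 2b ≥ S+1`.
[cite: KomaTasakiPRL1992, proof of eq. (10), inequalities i)–ii)] -/
theorem norm_trace_two_thermal_le {R Γ : Matrix n n ℂ} (hR : R.PosSemidef) (hΓh : Γ.IsHermitian)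
    (hΓΓ : Γ * Γ = 1) (A B : Matrix n n ℂ) (a b : ℕ) :
    ‖(Γ * R ^ a * A * R ^ b * B).trace‖ ≤
      ‖A‖ * ‖B‖ * (√(((R ^ (2 * a)).trace).re) * √(((R ^ (2 * b)).trace).re)) := by
  have hRh : ∀ c : ℕ, (R ^ c)ᴴ = R ^ c := fun c => by rw [conjTranspose_pow, hR.1.eq]
  set X : Matrix n n ℂ := Γ * R ^ a * A with hXdef
  set Y : Matrix n n ℂ := R ^ b * B with hYdef
  have hXY : Γ * R ^ a * A * R ^ b * B = X * Y := by
    simp only [hXdef, hYdef, Matrix.mul_assoc]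
  -- `Xᴴ X = Aᴴ R^{2a} A`, `Yᴴ Y = Bᴴ R^{2b} B`
  have hXX : Xᴴ * X = Aᴴ * (R ^ (2 * a) * A) := by
    have h2a : R ^ (2 * a) = R ^ a * R ^ a := by rw [two_mul, pow_add]
    simp only [hXdef, conjTranspose_mul, hRh, hΓh.eq, Matrix.mul_assoc]
    rw [← Matrix.mul_assoc Γ Γ, hΓΓ, Matrix.one_mul, ← Matrix.mul_assoc (R ^ a) (R ^ a), ← h2a]
  have hYY : Yᴴ * Y = Bᴴ * (R ^ (2 * b) * B) := by
    have h2b : R ^ (2 * b) = R ^ b * R ^ b := by rw [two_mul, pow_add]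
    simp only [hYdef, conjTranspose_mul, hRh, Matrix.mul_assoc]
    rw [← Matrix.mul_assoc (R ^ b) (R ^ b), ← h2b]
  -- Schwarz for the trace form
  have hS := norm_trace_mul_le X Y
  simp only [RCLike.re_to_complex] at hS
  rw [hXX, hYY] at hS
  -- the two Hilbert–Schmidt norms against `‖A‖² Tr R^{2a}`, `‖B‖² Tr R^{2b}`
  have hA : ((Aᴴ * (R ^ (2 * a) * A)).trace).re ≤ ‖A‖ ^ 2 * ((R ^ (2 * a)).trace).re :=
    re_trace_conjTranspose_mul_mul_le A (hR.pow _)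
  have hB : ((Bᴴ * (R ^ (2 * b) * B)).trace).re ≤ ‖B‖ ^ 2 * ((R ^ (2 * b)).trace).re :=
    re_trace_conjTranspose_mul_mul_le B (hR.pow _)
  have hsqA : √(((Aᴴ * (R ^ (2 * a) * A)).trace).re) ≤ ‖A‖ * √(((R ^ (2 * a)).trace).re) := by
    calc √(((Aᴴ * (R ^ (2 * a) * A)).trace).re) ≤ √(‖A‖ ^ 2 * ((R ^ (2 * a)).trace).re) :=
          Real.sqrt_le_sqrt hA
      _ = ‖A‖ * √(((R ^ (2 * a)).trace).re) := by
          rw [Real.sqrt_mul (sq_nonneg _), Real.sqrt_sq (norm_nonneg _)]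
  have hsqB : √(((Bᴴ * (R ^ (2 * b) * B)).trace).re) ≤ ‖B‖ * √(((R ^ (2 * b)).trace).re) := by
    calc √(((Bᴴ * (R ^ (2 * b) * B)).trace).re) ≤ √(‖B‖ ^ 2 * ((R ^ (2 * b)).trace).re) :=
          Real.sqrt_le_sqrt hB
      _ = ‖B‖ * √(((R ^ (2 * b)).trace).re) := by
          rw [Real.sqrt_mul (sq_nonneg _), Real.sqrt_sq (norm_nonneg _)]
  rw [hXY]
  calc ‖(X * Y).trace‖ ≤ √(((Aᴴ * (R ^ (2 * a) * A)).trace).re) * √(((Bᴴ * (R ^ (2 * b) * B)).trace).re) := hS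
    _ ≤ (‖A‖ * √(((R ^ (2 * a)).trace).re)) * (‖B‖ * √(((R ^ (2 * b)).trace).re)) :=
        mul_le_mul hsqA hsqB (Real.sqrt_nonneg _) (mul_nonneg (norm_nonneg _) (Real.sqrt_nonneg _))
    _ = ‖A‖ * ‖B‖ * (√(((R ^ (2 * a)).trace).re) * √(((R ^ (2 * b)).trace).re)) := by ring

/-- **The doubly-thermal twisted trace against ONE entropy sum.**  For `R ≥ 0`, a Hermitian involution `Γ`, and a power
`p` with `p ≤ 2a`, `p ≤ 2b`: `|Tr[Γ R^a A R^b B]| ≤ ‖A‖ ‖B‖ ‖R‖^{a+b−p} Re Tr R^p`.  In the assembly: `p = S+1`,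
`a = t₂`, `b = t₁` the two free stretches (`t₁ + t₂ = 2S+1 − w`), so the bound is `‖Â‖‖B̂‖ θ_{S+1} ‖R‖^{S−w}`, exponentially
small in `a_k S ≥ a_k n` by the norm gap — also for the separations `n > S − w` where both stretches are `≤ S`. -/
theorem norm_trace_two_thermal_le_of_le {R Γ : Matrix n n ℂ} (hR : R.PosSemidef) (hΓh : Γ.IsHermitian)
    (hΓΓ : Γ * Γ = 1) (A B : Matrix n n ℂ) {a b p : ℕ} (hpa : p ≤ 2 * a) (hpb : p ≤ 2 * b) :
    ‖(Γ * R ^ a * A * R ^ b * B).trace‖ ≤ ‖A‖ * ‖B‖ * (‖R‖ ^ (a + b - p) * ((R ^ p).trace).re) := by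
  have hp0 : 0 ≤ ((R ^ p).trace).re := by
    simpa only [RCLike.re_to_complex] using re_trace_nonneg_of_posSemidef (hR.pow p)
  -- transport both doubled powers down to `p`
  have h2a : ((R ^ (2 * a)).trace).re ≤ ‖R‖ ^ (2 * a - p) * ((R ^ p).trace).re := by
    have h := re_trace_pow_add_le hR (2 * a - p) p
    rwa [Nat.sub_add_cancel hpa] at h
  have h2b : ((R ^ (2 * b)).trace).re ≤ ‖R‖ ^ (2 * b - p) * ((R ^ p).trace).re := by
    have h := re_trace_pow_add_le hR (2 * b - p) p
    rwa [Nat.sub_add_cancel hpb] at h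
  have hprod : √(((R ^ (2 * a)).trace).re) * √(((R ^ (2 * b)).trace).re) ≤
      ‖R‖ ^ (a + b - p) * ((R ^ p).trace).re := by
    have hexp : ‖R‖ ^ (2 * a - p) * ((R ^ p).trace).re * (‖R‖ ^ (2 * b - p) * ((R ^ p).trace).re) =
        (‖R‖ ^ (a + b - p) * ((R ^ p).trace).re) ^ 2 := by
      have hsum : 2 * a - p + (2 * b - p) = 2 * (a + b - p) := by omega
      calc ‖R‖ ^ (2 * a - p) * ((R ^ p).trace).re * (‖R‖ ^ (2 * b - p) * ((R ^ p).trace).re)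
          = ‖R‖ ^ (2 * a - p + (2 * b - p)) * ((R ^ p).trace).re ^ 2 := by rw [pow_add]; ring
        _ = (‖R‖ ^ (a + b - p) * ((R ^ p).trace).re) ^ 2 := by rw [hsum, pow_mul]; ring
    calc √(((R ^ (2 * a)).trace).re) * √(((R ^ (2 * b)).trace).re)
        ≤ √(‖R‖ ^ (2 * a - p) * ((R ^ p).trace).re) * √(‖R‖ ^ (2 * b - p) * ((R ^ p).trace).re) :=
          mul_le_mul (Real.sqrt_le_sqrt h2a) (Real.sqrt_le_sqrt h2b) (Real.sqrt_nonneg _) (Real.sqrt_nonneg _)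
      _ = √(‖R‖ ^ (2 * a - p) * ((R ^ p).trace).re * (‖R‖ ^ (2 * b - p) * ((R ^ p).trace).re)) :=
          (Real.sqrt_mul (mul_nonneg (pow_nonneg (norm_nonneg _) _) hp0) _).symm
      _ = ‖R‖ ^ (a + b - p) * ((R ^ p).trace).re := by
          rw [hexp, Real.sqrt_sq (mul_nonneg (pow_nonneg (norm_nonneg _) _) hp0)]
  exact (norm_trace_two_thermal_le hR hΓh hΓΓ A B a b).trans
    (mul_le_mul_of_nonneg_left hprod (mul_nonneg (norm_nonneg _) (norm_nonneg _)))

end Matrices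

/-! ### From offset bounds to the uniform lattice gap -/

variable {Nf : ℕ}

/-- **Offset bookkeeping of the assembly.**  If for every pair of gauge-invariant local observables there are a width `w`
and a constant `K` such that, eventually in `k`, on every torus `S ≥ L_k`: the connected correlation is bounded by `K` at
the separations `n ≤ w` (overlapping supports) and by `K e^{−Δ a_k (n − w)}` at `w < n ≤ S` (the free stretch between the
slabs is `n − w`), then the scheme has the uniform lattice mass gap `Δ` — with the constant `max K 0 · e^{Δ w}`, using only
`a_k → 0` (so `a_k ≤ 1` eventually). [folklore] -/
theorem hasLatticeMassGap_of_offset_bounds (sch : QCDScheme Nf) {Δ : ℝ} (hΔ : 0 ≤ Δ)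
    (h : ∀ (R R' : ℕ) (A : QCDLatticeObservable Nf R) (B : QCDLatticeObservable Nf R'),
      ∃ (w : ℕ) (K : ℝ), ∀ᶠ k in atTop, ∀ S : ℕ, sch.L k ≤ S → ∀ n : ℕ, n ≤ S →
        (n ≤ w → ‖qcdLatticeConnectedCorr (sch.β k) (2 * S + 1) (fun fl => sch.mq fl k) A B n‖ ≤ K) ∧
        (w < n → ‖qcdLatticeConnectedCorr (sch.β k) (2 * S + 1) (fun fl => sch.mq fl k) A B n‖ ≤
          K * Real.exp (-(Δ * (sch.a k * (n - w)))))) :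
    sch.HasLatticeMassGap Δ := by
  intro R R' A B
  obtain ⟨w, K, hK⟩ := h R R' A B
  refine ⟨max K 0 * Real.exp (Δ * w), ?_⟩
  have ha1 : ∀ᶠ k in atTop, sch.a k ≤ 1 := sch.tendsto_a.eventually (eventually_le_nhds one_pos)
  filter_upwards [hK, ha1] with k hk hak S hS n hn
  obtain ⟨h1, h2⟩ := hk S hS n hn
  have ha0 : 0 ≤ sch.a k := (sch.a_pos k).le
  have hK0 : 0 ≤ max K 0 := le_max_right _ _
  have haw : sch.a k * w ≤ w := by
    calc sch.a k * w ≤ 1 * w := mul_le_mul_of_nonneg_right hak (Nat.cast_nonneg w)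
      _ = w := one_mul _
  by_cases hnw : n ≤ w
  · -- overlapping supports: a constant bound is an exponential bound with constant `K e^{Δ w}`
    have hexp : 1 ≤ Real.exp (Δ * w) * Real.exp (-(Δ * (sch.a k * n))) := by
      rw [← Real.exp_add]
      apply Real.one_le_exp
      have han : sch.a k * n ≤ w :=
        (mul_le_mul_of_nonneg_left (Nat.cast_le.2 hnw) ha0).trans haw
      nlinarith
    calc ‖qcdLatticeConnectedCorr (sch.β k) (2 * S + 1) (fun fl => sch.mq fl k) A B n‖ ≤ K := h1 hnw
      _ ≤ max K 0 := le_max_left _ _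
      _ ≤ max K 0 * (Real.exp (Δ * w) * Real.exp (-(Δ * (sch.a k * n)))) :=
          le_mul_of_one_le_right hK0 hexp
      _ = max K 0 * Real.exp (Δ * w) * Real.exp (-(Δ * (sch.a k * n))) := by ring
  · -- separated supports: shift the offset `w` into the constant
    replace hnw : w < n := not_le.mp hnw
    have hsplit : Real.exp (-(Δ * (sch.a k * (n - w)))) =
        Real.exp (Δ * (sch.a k * w)) * Real.exp (-(Δ * (sch.a k * n))) := by
      rw [← Real.exp_add]
      congr 1
      ring
    have hew : Real.exp (Δ * (sch.a k * w)) ≤ Real.exp (Δ * w) :=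
      Real.exp_le_exp.2 (mul_le_mul_of_nonneg_left haw hΔ)
    calc ‖qcdLatticeConnectedCorr (sch.β k) (2 * S + 1) (fun fl => sch.mq fl k) A B n‖
        ≤ K * Real.exp (-(Δ * (sch.a k * (n - w)))) := h2 hnw
      _ ≤ max K 0 * Real.exp (-(Δ * (sch.a k * (n - w)))) :=
          mul_le_mul_of_nonneg_right (le_max_left _ _) (Real.exp_pos _).le
      _ = max K 0 * Real.exp (Δ * (sch.a k * w)) * Real.exp (-(Δ * (sch.a k * n))) := by
          rw [hsplit, mul_assoc]
      _ ≤ max K 0 * Real.exp (Δ * w) * Real.exp (-(Δ * (sch.a k * n))) := by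
          gcongr

end LatticeGapAssembly

/-- **Twisted-trace clustering bound, fourth inequality (registered sub-goal `twistedClusterBound_twoThermal`).**
The complement of `stub_twistedClusterBound` that the assembly needs for observables of non-zero temporal width: for
`R ≥ 0`, a Hermitian involution `Γ` and any power `p ≤ 2a`, `p ≤ 2b`, the doubly-thermal term of the twisted two-time trace
obeys `|Tr[Γ R^a A R^b B]| ≤ ‖A‖ ‖B‖ ‖R‖^{a+b−p} Re Tr R^p` (`ℓ²` operator norm) — both free stretches `a, b` may be shorter
than `p` as long as their doubles are not, so the cold-pressure number at the single power `p = S+1` and the norm gap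
control every separation `n ≤ S` (Schwarz for the trace form + Hölder; `LatticeGapAssembly.norm_trace_two_thermal_le_of_le`).
[cite: KomaTasakiPRL1992, proof of eq. (10), inequalities i)–ii)] -/
theorem twistedClusterBound_twoThermal : ∀ (n : Type) [Fintype n] [DecidableEq n] (Γ R A B : Matrix n n ℂ), R.PosSemidef → Γ.IsHermitian → Γ * Γ = 1 → ∀ a b p : ℕ, p ≤ 2 * a → p ≤ 2 * b → ‖(Γ * R ^ a * A * R ^ b * B).trace‖ ≤ ‖A‖ * ‖B‖ * (‖R‖ ^ (a + b - p) * ((R ^ p).trace).re) :=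
  fun _ _ _ _ _ A B hR hΓh hΓΓ _ _ _ hpa hpb =>
    LatticeGapAssembly.norm_trace_two_thermal_le_of_le hR hΓh hΓΓ A B hpa hpb

end Summit.QuantumFields.QCD.Theorems.AnomalyBranch

end
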